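/-
Copyright (c) 2026. Released under Apache 2.0 license as described in the file LICENSE.
Track B ∕ K2-LIT, crux h413 = `stmt-HodgeConjecture-24833`; seat `hodgecm-mathlib-K2E3-p12` (g7); deal (69) «(f3-sph)», FILE A (gap (GP)).
-/
import Mathlib.Analysis.MellinInversion
import Mathlib.Analysis.SpecialFunctions.ImproperIntegrals
import Mathlib.MeasureTheory.Integral.IntegralEqImproper
import Mathlib.Analysis.Calculus.Deriv.Support
import Mathlib.MeasureTheory.Integral.Prod
import HarnessLib

/-!
# K2·E1 — `K2E1MellinPaleyWienerHalfLine`: MELLIN ANALYSIS OF `C²_c((0,∞))` — convergence, holomorphy, integration by parts, `O(y⁻²)` decay, inversion in the «`H^z`»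
# convention, and the two PARSEVAL identities of the pseudo-Eisenstein inner product formula [MoeglinWaldspurger1995, II.1.2–II.1.4, II.2.1] (pure analysis)

Track B ∕ K2-LIT, crux h413 = `stmt-HodgeConjecture-24833`, route `HCCMUnconditional`; cell `hodgecm-mathlib`, squad K2, ENGINE E1; dealer K2E1-plan (g6) deal (69) 2026-09-04
(«(f3-sph) `K2E1PseudoEisensteinInnerProductCMTwo`»): gap **(GP)** of the census (seat `hodgecm-mathlib-K2E3-p12` (g7)).  THEOREMS ONLY (no `def`, no `instance`, no notation, no
named-fact hypothesis, no `sorry`); lane `--supports stmt-HodgeConjecture-24833 --as helper` (count-neutral).  Closes no socket.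
CONVENTION.  Mathlib's `mellin f s = ∫_{(0,∞)} t^{s−1} f(t) dt`; the Eisenstein variable is `z` (`H^z`), so the transform of record is `f̃(z) := mellin f (−z)` and the inversion reads
`f(r) = (2π)⁻¹ ∫_ℝ r^{σ₀+iy} f̃(σ₀+iy) dy`.  For `f, g ∈ C²_c((0,∞))` (`ContDiff ℝ 2`, compact support, `tsupport ⊆ (0,∞)`): §1 convergence at ALL `s`, whole-line integral, norm bound,
holomorphy; §2 INTEGRATION BY PARTS `mellin f s = −s⁻¹·mellin f′ (s+1)`, twice; §3 DECAY `‖mellin f (σ+iy)‖ ≤ B(σ)∕y²`, **`verticalIntegrable_mellin`** (every `σ`); §4 INVERSION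
**`eq_integral_cpow_mul_mellin_neg`**; §5 `mellin_conj`, a product-majorant Fubini swap, PARSEVAL I **`setIntegral_mul_conj_mul_cpow_eq`**
(`∫_0^∞ f·conj g·r^{−2} dr = (2π)⁻¹∫ f̃(z)·conj g̃(1−z̄) dy`, `z = σ₀+iy`) and PARSEVAL II **`setIntegral_mul_cpow_mul_conj_integral_eq`** (for `c` continuous bounded on the line:
`∫_0^∞ f(r) r^{−2} conj((2π)⁻¹∫ g̃(w)c(w)r^{1−w}) dr = (2π)⁻¹ ∫ f̃(z)·conj g̃(z̄)·conj c(z̄) dy`) — the `w = 1` and `w = w₀` terms of MW II.2.1 in rank one.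
HONEST LABEL: HC_CM is proved only modulo the 7 printed citations (2 remaining named inputs: hLiu418 = `stmt-HodgeConjecture-24832`, h413 = `stmt-HodgeConjecture-24833`) until rung 0
closes; this file asserts no named fact and closes no socket.  References: [MoeglinWaldspurger1995] II.1.2–II.1.4, II.2.1; [Garrett2018] §1.8; [Titchmarsh1948] §1.29, Thm 71–72.
-/

set_option autoImplicit false
-- the mandated namespace repeats the single-problem summit's segment (`HodgeConjecture.HodgeConjecture`)
set_option linter.dupNamespace false

noncomputable section

open MeasureTheory Set Filter Topology Complex Asymptotics
open scoped ComplexConjugate Real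

namespace Summit.HodgeConjecture.HodgeConjecture.Cruxes.H413.K2E1MellinPaleyWienerHalfLine

variable {f g : ℝ → ℂ}

/-! ## §1 Convergence everywhere, the whole-line integral, the norm bound, holomorphy -/

/-- `t ↦ t^s·f(t)` is continuous on ALL of `ℝ` when `f` is continuous with `tsupport f ⊆ (0,∞)` (near `t ≤ 0` the product vanishes identically). [cite: Titchmarsh1948, §1.29] -/
theorem continuous_ofReal_cpow_mul (hfc : Continuous f) (hf0 : tsupport f ⊆ Ioi 0) (s : ℂ) :
    Continuous fun t : ℝ => (t : ℂ) ^ s * f t := by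
  refine continuous_iff_continuousAt.2 fun t => ?_
  by_cases ht : 0 < t
  · exact (continuousAt_ofReal_cpow_const t s (Or.inr ht.ne')).mul hfc.continuousAt
  · have hmem : t ∉ tsupport f := fun h => ht (hf0 h)
    have h0 : f =ᶠ[𝓝 t] 0 := notMem_tsupport_iff_eventuallyEq.1 hmem
    refine (continuousAt_const (y := (0 : ℂ))).congr ?_
    filter_upwards [h0] with u hu
    simp only [hu, Pi.zero_apply, mul_zero]

/-- `t ↦ t^s·f(t)` is integrable on `ℝ` for continuous compactly supported `f` with `tsupport f ⊆ (0,∞)`. [cite: Titchmarsh1948, §1.29] -/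
theorem integrable_ofReal_cpow_mul (hfc : Continuous f) (hfs : HasCompactSupport f) (hf0 : tsupport f ⊆ Ioi 0) (s : ℂ) :
    Integrable fun t : ℝ => (t : ℂ) ^ s * f t :=
  (continuous_ofReal_cpow_mul hfc hf0 s).integrable_of_hasCompactSupport hfs.mul_left

/-- **The Mellin transform of a continuous compactly supported function on `(0,∞)` converges at EVERY `s`.** [cite: Titchmarsh1948, §1.29] -/
theorem mellinConvergent_of_tsupport_subset_Ioi (hfc : Continuous f) (hfs : HasCompactSupport f) (hf0 : tsupport f ⊆ Ioi 0) (s : ℂ) :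
    MellinConvergent f s := by
  unfold MellinConvergent
  simp only [smul_eq_mul]
  exact (integrable_ofReal_cpow_mul hfc hfs hf0 (s - 1)).integrableOn

/-- The Mellin integral is the integral over the whole line (the integrand vanishes off `(0,∞)`). [cite: Titchmarsh1948, §1.29] -/
theorem mellin_eq_integral (hf0 : tsupport f ⊆ Ioi 0) (s : ℂ) : mellin f s = ∫ t : ℝ, (t : ℂ) ^ (s - 1) * f t := by
  simp only [mellin, smul_eq_mul]
  refine setIntegral_eq_integral_of_forall_compl_eq_zero fun t ht => ?_
  rw [image_eq_zero_of_notMem_tsupport fun h => ht (hf0 h), mul_zero]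

/-- `‖mellin f s‖ ≤ ∫_0^∞ t^{Re s − 1}·‖f t‖ dt`. [cite: Titchmarsh1948, §1.29] -/
theorem norm_mellin_le (f : ℝ → ℂ) (s : ℂ) : ‖mellin f s‖ ≤ ∫ t in Ioi 0, t ^ (s.re - 1) * ‖f t‖ := by
  simp only [mellin, smul_eq_mul]
  refine (norm_integral_le_integral_norm _).trans_eq (setIntegral_congr_fun measurableSet_Ioi fun t ht => ?_)
  rw [norm_mul, norm_cpow_eq_rpow_re_of_pos ht, sub_re, one_re]

/-- **`mellin f` is entire** for continuous compactly supported `f` on `(0,∞)` (Mathlib `mellin_differentiableAt_of_isBigO_rpow`: `f` vanishes near `0` and near `∞`). [cite: Titchmarsh1948, §1.29] -/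
theorem differentiable_mellin (hfc : Continuous f) (hfs : HasCompactSupport f) (hf0 : tsupport f ⊆ Ioi 0) : Differentiable ℂ (mellin f) := by
  intro s
  have htop : f =ᶠ[atTop] (0 : ℝ → ℂ) := by
    obtain ⟨R, hR⟩ := (hfs.isCompact.isBounded).subset_closedBall 0
    filter_upwards [eventually_gt_atTop R] with t ht
    refine image_eq_zero_of_notMem_tsupport fun h => ?_
    have := hR h
    rw [Metric.mem_closedBall, dist_zero_right, Real.norm_eq_abs] at this
    exact absurd (le_of_abs_le this) (not_le.2 ht)
  have hbot : f =ᶠ[𝓝[>] 0] (0 : ℝ → ℂ) := (notMem_tsupport_iff_eventuallyEq.1 fun h => lt_irrefl (0 : ℝ) (hf0 h)).filter_mono nhdsWithin_le_nhds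
  refine mellin_differentiableAt_of_isBigO_rpow (a := s.re + 1) (b := s.re - 1) ((hfc.locallyIntegrable (μ := volume)).locallyIntegrableOn (Ioi 0)) ?_ (by linarith) ?_ (by linarith)
  · exact (isBigO_zero _ _).congr' htop.symm EventuallyEq.rfl
  · exact (isBigO_zero _ _).congr' hbot.symm EventuallyEq.rfl

/-- `mellin f` restricted to a vertical line is continuous. [cite: Titchmarsh1948, §1.29] -/
theorem continuous_mellin_vertical (hfc : Continuous f) (hfs : HasCompactSupport f) (hf0 : tsupport f ⊆ Ioi 0) (σ : ℝ) :
    Continuous fun y : ℝ => mellin f ((σ : ℂ) + y * I) :=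
  (differentiable_mellin hfc hfs hf0).continuous.comp (by fun_prop)

/-! ## §2 Integration by parts -/

/-- The derivative of a `C¹` function supported in `(0,∞)` is continuous, compactly supported and supported in `(0,∞)`. [folklore] -/
theorem deriv_data (hf : ContDiff ℝ 1 f) (hfs : HasCompactSupport f) (hf0 : tsupport f ⊆ Ioi 0) :
    Continuous (deriv f) ∧ HasCompactSupport (deriv f) ∧ tsupport (deriv f) ⊆ Ioi 0 :=
  ⟨hf.continuous_deriv le_rfl, hfs.deriv, tsupport_deriv_subset.trans hf0⟩

/-- **INTEGRATION BY PARTS**: `mellin f s = −s⁻¹ · mellin f′ (s+1)` for `f ∈ C¹_c((0,∞))`, `s ≠ 0` (boundary terms vanish). [cite: Titchmarsh1948, §1.29] -/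
theorem mellin_eq_neg_inv_mul_mellin_deriv (hf : ContDiff ℝ 1 f) (hfs : HasCompactSupport f) (hf0 : tsupport f ⊆ Ioi 0) {s : ℂ} (hs : s ≠ 0) :
    mellin f s = -(s⁻¹ * mellin (deriv f) (s + 1)) := by
  obtain ⟨hdc, hds, hd0⟩ := deriv_data hf hfs hf0
  rw [mellin_eq_integral hf0, mellin_eq_integral hd0, add_sub_cancel_right]
  -- `u = t^s∕s`, `u′ = t^{s−1}`, `v = f`, `v′ = f′`
  have hibp := integral_mul_deriv_eq_deriv_mul_of_integrable (u := fun t : ℝ => (t : ℂ) ^ s * s⁻¹) (u' := fun t : ℝ => (t : ℂ) ^ (s - 1))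
    (v := f) (v' := deriv f) (fun t ht => ?_) (fun t _ => ((hf.differentiable one_ne_zero) t).hasDerivAt) ?_ ?_ ?_
  · calc ∫ t : ℝ, (t : ℂ) ^ (s - 1) * f t = -∫ t : ℝ, (t : ℂ) ^ s * s⁻¹ * deriv f t := by rw [hibp, neg_neg]
      _ = -(s⁻¹ * ∫ t : ℝ, (t : ℂ) ^ s * deriv f t) := by
        rw [← integral_const_mul]; congr 2; funext t; ring
  · have ht' : t ≠ 0 := (hf0 ht).ne'
    have h := (hasDerivAt_ofReal_cpow_const ht' hs).mul_const s⁻¹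
    refine h.congr_deriv ?_
    field_simp
  · exact ((integrable_ofReal_cpow_mul hdc hds hd0 s).const_mul s⁻¹).congr (Eventually.of_forall fun t => by simp only [Pi.mul_apply]; ring)
  · exact integrable_ofReal_cpow_mul hf.continuous hfs hf0 (s - 1)
  · exact ((integrable_ofReal_cpow_mul hf.continuous hfs hf0 s).const_mul s⁻¹).congr (Eventually.of_forall fun t => by simp only [Pi.mul_apply]; ring)

/-- **INTEGRATION BY PARTS, TWICE**: `mellin f s = (s(s+1))⁻¹ · mellin f″ (s+2)` for `f ∈ C²_c((0,∞))`, `s ≠ 0, −1`. [cite: Titchmarsh1948, §1.29] -/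
theorem mellin_eq_inv_mul_mellin_deriv_deriv (hf : ContDiff ℝ 2 f) (hfs : HasCompactSupport f) (hf0 : tsupport f ⊆ Ioi 0) {s : ℂ} (hs : s ≠ 0) (hs1 : s + 1 ≠ 0) :
    mellin f s = (s * (s + 1))⁻¹ * mellin (deriv (deriv f)) (s + 2) := by
  have h2 : ContDiff ℝ ((1 : WithTop ℕ∞) + 1) f := by rw [one_add_one_eq_two]; exact hf
  have hf1 : ContDiff ℝ 1 f := hf.of_le (by norm_num)
  have hd1 : ContDiff ℝ 1 (deriv f) := h2.deriv'
  obtain ⟨-, hds, hd0⟩ := deriv_data hf1 hfs hf0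
  rw [mellin_eq_neg_inv_mul_mellin_deriv hf1 hfs hf0 hs, mellin_eq_neg_inv_mul_mellin_deriv hd1 hds hd0 hs1,
    show s + 1 + 1 = s + 2 by ring, mul_inv]
  ring

/-! ## §3 Decay on vertical lines and vertical integrability -/

/-- The uniform bound on a vertical line: `‖mellin f (σ+iy)‖ ≤ ∫_0^∞ t^{σ−1}‖f t‖ dt`. [cite: Titchmarsh1948, §1.29] -/
theorem norm_mellin_vertical_le (f : ℝ → ℂ) (σ y : ℝ) : ‖mellin f ((σ : ℂ) + y * I)‖ ≤ ∫ t in Ioi 0, t ^ (σ - 1) * ‖f t‖ := by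
  have h := norm_mellin_le f ((σ : ℂ) + y * I)
  simp only [add_re, ofReal_re, mul_re, I_re, mul_zero, ofReal_im, I_im, mul_one, sub_self, add_zero] at h
  exact h

/-- **DECAY `O(y⁻²)`**: `‖mellin f (σ+iy)‖ ≤ (∫_0^∞ t^{σ+1}‖f″ t‖ dt) ∕ y²` for `y ≠ 0`, `f ∈ C²_c((0,∞))`. [cite: Titchmarsh1948, §1.29] -/
theorem norm_mellin_vertical_le_div_sq (hf : ContDiff ℝ 2 f) (hfs : HasCompactSupport f) (hf0 : tsupport f ⊆ Ioi 0) (σ : ℝ) {y : ℝ} (hy : y ≠ 0) :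
    ‖mellin f ((σ : ℂ) + y * I)‖ ≤ (∫ t in Ioi 0, t ^ (σ + 1) * ‖deriv (deriv f) t‖) / y ^ 2 := by
  set s : ℂ := (σ : ℂ) + y * I with hs_def
  have hsim : s.im = y := by simp [hs_def]
  have hs : s ≠ 0 := fun h => hy (by rw [← hsim, h, zero_im])
  have hs1 : s + 1 ≠ 0 := fun h => hy (by simpa [hs_def] using congrArg Complex.im h)
  have hB : ‖mellin (deriv (deriv f)) (s + 2)‖ ≤ ∫ t in Ioi 0, t ^ (σ + 1) * ‖deriv (deriv f) t‖ := by
    have h := norm_mellin_le (deriv (deriv f)) (s + 2); rwa [show (s + 2).re - 1 = σ + 1 by simp [hs_def]; ring] at h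
  have hys : |y| ≤ ‖s‖ := by rw [← hsim]; exact abs_im_le_norm s
  have hys1 : |y| ≤ ‖s + 1‖ := by rw [← show (s + 1).im = y by simp [hs_def]]; exact abs_im_le_norm (s + 1)
  have hy2 : y ^ 2 ≤ ‖s‖ * ‖s + 1‖ := by rw [← sq_abs, sq]; exact mul_le_mul hys hys1 (abs_nonneg y) (norm_nonneg _)
  have hy2pos : 0 < y ^ 2 := by positivity
  rw [mellin_eq_inv_mul_mellin_deriv_deriv hf hfs hf0 hs hs1, norm_mul, norm_inv, norm_mul, le_div_iff₀ hy2pos]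
  have ha0 : 0 ≤ ‖s‖ * ‖s + 1‖ := by positivity
  have hB0 : 0 ≤ ∫ t in Ioi 0, t ^ (σ + 1) * ‖deriv (deriv f) t‖ := (norm_nonneg _).trans hB
  calc (‖s‖ * ‖s + 1‖)⁻¹ * ‖mellin (deriv (deriv f)) (s + 2)‖ * y ^ 2
      ≤ (‖s‖ * ‖s + 1‖)⁻¹ * (∫ t in Ioi 0, t ^ (σ + 1) * ‖deriv (deriv f) t‖) * (‖s‖ * ‖s + 1‖) :=
        mul_le_mul (mul_le_mul_of_nonneg_left hB (inv_nonneg.2 ha0)) hy2 hy2pos.le (mul_nonneg (inv_nonneg.2 ha0) hB0)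
    _ = ∫ t in Ioi 0, t ^ (σ + 1) * ‖deriv (deriv f) t‖ := by
        have hne : ‖s‖ * ‖s + 1‖ ≠ 0 := mul_ne_zero (norm_ne_zero_iff.2 hs) (norm_ne_zero_iff.2 hs1)
        field_simp

/-- **VERTICAL INTEGRABILITY on every line**: `y ↦ mellin f (σ+iy)` is integrable (`f ∈ C²_c((0,∞))`): continuous and `≤ C·(1+y²)⁻¹`. [cite: Titchmarsh1948, §1.29] -/
theorem verticalIntegrable_mellin (hf : ContDiff ℝ 2 f) (hfs : HasCompactSupport f) (hf0 : tsupport f ⊆ Ioi 0) (σ : ℝ) :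
    VerticalIntegrable (mellin f) σ := by
  unfold VerticalIntegrable
  set B₀ : ℝ := ∫ t in Ioi 0, t ^ (σ - 1) * ‖f t‖
  set B₂ : ℝ := ∫ t in Ioi 0, t ^ (σ + 1) * ‖deriv (deriv f) t‖; set C : ℝ := 2 * max B₀ B₂
  have hB₀ : 0 ≤ B₀ := setIntegral_nonneg measurableSet_Ioi fun t ht => mul_nonneg (Real.rpow_nonneg ht.le _) (norm_nonneg _)
  have hB₂ : 0 ≤ B₂ := setIntegral_nonneg measurableSet_Ioi fun t ht => mul_nonneg (Real.rpow_nonneg ht.le _) (norm_nonneg _)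
  refine Integrable.mono' (integrable_inv_one_add_sq.const_mul C) (continuous_mellin_vertical hf.continuous hfs hf0 σ).aestronglyMeasurable
    (Eventually.of_forall fun y => ?_)
  have h0 := norm_mellin_vertical_le f σ y
  by_cases hy1 : y ^ 2 ≤ 1
  · -- small `y`: the uniform bound
    calc ‖mellin f ((σ : ℂ) + y * I)‖ ≤ B₀ := h0
      _ ≤ max B₀ B₂ := le_max_left _ _
      _ ≤ C * (1 + y ^ 2)⁻¹ := by
        rw [show C = 2 * max B₀ B₂ from rfl, mul_assoc]
        have h1 : (1 : ℝ) ≤ 2 * (1 + y ^ 2)⁻¹ := by rw [← div_eq_mul_inv, le_div_iff₀ (by positivity)]; linarith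
        calc max B₀ B₂ = max B₀ B₂ * 1 := (mul_one _).symm
          _ ≤ max B₀ B₂ * (2 * (1 + y ^ 2)⁻¹) := mul_le_mul_of_nonneg_left h1 (hB₀.trans (le_max_left _ _))
          _ = 2 * (max B₀ B₂ * (1 + y ^ 2)⁻¹) := by ring
  · -- large `y`: the `y⁻²` decay
    have hy : y ≠ 0 := fun h => hy1 (by rw [h]; norm_num)
    have hy1' : 1 ≤ y ^ 2 := (not_le.1 hy1).le
    calc ‖mellin f ((σ : ℂ) + y * I)‖ ≤ B₂ / y ^ 2 := norm_mellin_vertical_le_div_sq hf hfs hf0 σ hy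
      _ ≤ max B₀ B₂ * (2 * (1 + y ^ 2)⁻¹) := by
        rw [div_eq_mul_inv]
        refine mul_le_mul (le_max_right _ _) ?_ (by positivity) (hB₀.trans (le_max_left _ _))
        rw [inv_eq_one_div, ← div_eq_mul_inv, div_le_div_iff₀ (by positivity) (by positivity)]; linarith
      _ = C * (1 + y ^ 2)⁻¹ := by ring

/-! ## §4 Inversion in the `H^z` convention -/

/-- **MELLIN INVERSION (the «`H^z`» convention)**: for `f ∈ C²_c((0,∞))`, every `σ₀ : ℝ` and `r > 0`,
`f r = (2π)⁻¹ ∫_ℝ r^{σ₀+iy} · mellin f (−(σ₀+iy)) dy` (Mathlib `mellinInv_mellin_eq` at `σ = −σ₀`, then `y ↦ −y`). [cite: Titchmarsh1948, Thm 71–72] [cite: MoeglinWaldspurger1995, II.1.4] -/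
theorem eq_integral_cpow_mul_mellin_neg (hf : ContDiff ℝ 2 f) (hfs : HasCompactSupport f) (hf0 : tsupport f ⊆ Ioi 0) (σ₀ : ℝ) {r : ℝ} (hr : 0 < r) :
    f r = (((2 * π)⁻¹ : ℝ) : ℂ) * ∫ y : ℝ, (r : ℂ) ^ ((σ₀ : ℂ) + y * I) * mellin f (-((σ₀ : ℂ) + y * I)) := by
  have h := mellinInv_mellin_eq (-σ₀) f hr (mellinConvergent_of_tsupport_subset_Ioi hf.continuous hfs hf0 _)
    (verticalIntegrable_mellin hf hfs hf0 (-σ₀)) hf.continuous.continuousAt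
  rw [← h, mellinInv, Complex.real_smul, one_div]
  congr 1
  rw [← integral_neg_eq_self]
  refine integral_congr_ae (Eventually.of_forall fun y => ?_)
  simp only [smul_eq_mul, ofReal_neg, neg_mul]
  congr 2 <;> ring

/-! ## §5 Conjugation and the two Parseval identities -/

/-- `mellin (conj ∘ g) s = conj (mellin g (conj s))` (for `t > 0`, `conj (t^{w}) = t^{conj w}`). [cite: Titchmarsh1948, §1.29] -/
theorem mellin_conj (g : ℝ → ℂ) (s : ℂ) : mellin (fun t => conj (g t)) s = conj (mellin g (conj s)) := by
  simp only [mellin, smul_eq_mul, ← integral_conj, map_mul]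
  refine setIntegral_congr_fun measurableSet_Ioi fun t ht => ?_
  congr 1
  have harg : ((t : ℂ)).arg ≠ π := by rw [arg_ofReal_of_nonneg ht.le]; exact Real.pi_pos.ne
  rw [show conj s - 1 = conj (s - 1) by rw [map_sub, map_one], cpow_conj _ _ harg, conj_ofReal, conj_conj]

/-- A Fubini swap on `(0,∞) × ℝ` under a product majorant (the form both Parseval identities use). [folklore] -/
theorem integral_integral_swap_of_le {Φ : ℝ → ℝ → ℂ} (hΦ : ContinuousOn (Function.uncurry Φ) (Ioi (0 : ℝ) ×ˢ univ)) {a b : ℝ → ℝ}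
    (ha : IntegrableOn a (Ioi 0)) (hb : Integrable b) (hle : ∀ r ∈ Ioi (0 : ℝ), ∀ y : ℝ, ‖Φ r y‖ ≤ a r * b y) :
    Integrable (Function.uncurry Φ) ((volume.restrict (Ioi (0 : ℝ))).prod volume) ∧
      ∫ r in Ioi 0, ∫ y, Φ r y = ∫ y, ∫ r in Ioi 0, Φ r y := by
  have hμ : (volume.restrict (Ioi (0 : ℝ))).prod (volume : Measure ℝ) = (volume.prod volume).restrict (Ioi 0 ×ˢ univ) := by
    rw [← Measure.prod_restrict, Measure.restrict_univ]
  have hmeas : AEStronglyMeasurable (Function.uncurry Φ) ((volume.restrict (Ioi (0 : ℝ))).prod volume) := by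
    rw [hμ]
    exact hΦ.aestronglyMeasurable (measurableSet_Ioi.prod MeasurableSet.univ)
  have hint : Integrable (Function.uncurry Φ) ((volume.restrict (Ioi (0 : ℝ))).prod volume) := by
    refine Integrable.mono' (ha.mul_prod hb) hmeas ?_
    have hμ' : ∀ᵐ p : ℝ × ℝ ∂((volume.restrict (Ioi (0 : ℝ))).prod volume), p ∈ Ioi (0 : ℝ) ×ˢ (univ : Set ℝ) := by
      rw [hμ]
      exact ae_restrict_mem (measurableSet_Ioi.prod MeasurableSet.univ)
    filter_upwards [hμ'] with p hp
    exact hle p.1 hp.1 p.2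
  exact ⟨hint, integral_integral_swap hint⟩

/-- Joint continuity of `(r, y) ↦ r^{σ₀+iy}` on `(0,∞) × ℝ`. [folklore] -/
theorem continuousOn_cpow_two (σ₀ : ℝ) : ContinuousOn (fun p : ℝ × ℝ => (p.1 : ℂ) ^ ((σ₀ : ℂ) + p.2 * I)) (Ioi (0 : ℝ) ×ˢ univ) := by
  intro p hp
  have h1 : ContinuousAt (fun q : ℝ × ℝ => (q.1 : ℂ)) p := (continuous_ofReal.comp continuous_fst).continuousAt
  have h2 : ContinuousAt (fun q : ℝ × ℝ => (σ₀ : ℂ) + q.2 * I) p := by fun_prop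
  exact (h1.cpow h2 (ofReal_mem_slitPlane.2 hp.1)).continuousWithinAt

/-- **PARSEVAL I** (the `w = 1` term of MW II.2.1 in rank one): for `f ∈ C²_c((0,∞))`, `g ∈ C_c((0,∞))` and any `σ₀`,
`∫_0^∞ f(r)·conj g(r)·r^{−2} dr = (2π)⁻¹ ∫_ℝ f̃(z)·conj(g̃(1 − z̄)) dy`, `z = σ₀ + iy`, `f̃(z) = mellin f (−z)`, `g̃(1 − z̄) = mellin g (z̄ − 1)`
(inversion §4 inside, Fubini over `(0,∞) × ℝ`, `mellin_conj`). [cite: MoeglinWaldspurger1995, II.2.1] [cite: Titchmarsh1948, Thm 71–72] -/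
theorem setIntegral_mul_conj_mul_cpow_eq (hf : ContDiff ℝ 2 f) (hfs : HasCompactSupport f) (hf0 : tsupport f ⊆ Ioi 0)
    (hgc : Continuous g) (hgs : HasCompactSupport g) (hg0 : tsupport g ⊆ Ioi 0) (σ₀ : ℝ) :
    ∫ r in Ioi (0 : ℝ), f r * conj (g r) * (r : ℂ) ^ (-2 : ℂ) =
      (((2 * π)⁻¹ : ℝ) : ℂ) * ∫ y : ℝ, mellin f (-((σ₀ : ℂ) + y * I)) * conj (mellin g (conj ((σ₀ : ℂ) + y * I) - 1)) := by
  set κ : ℂ := (((2 * π)⁻¹ : ℝ) : ℂ) with hκ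
  -- the transform on the line `Re = σ₀` (in the `H^z` convention) and its integrability
  have hFc : Continuous fun y : ℝ => mellin f (-((σ₀ : ℂ) + y * I)) :=
    (differentiable_mellin hf.continuous hfs hf0).continuous.comp (by fun_prop)
  have hFi : Integrable fun y : ℝ => ‖mellin f (-((σ₀ : ℂ) + y * I))‖ := by
    have h := (verticalIntegrable_mellin hf hfs hf0 (-σ₀)).comp_neg
    refine (h.congr (Eventually.of_forall fun y => ?_)).norm
    simp only [ofReal_neg]; congr 1; ring
  -- Step 1: inversion inside the `r`-integral
  have h1 : ∫ r in Ioi (0 : ℝ), f r * conj (g r) * (r : ℂ) ^ (-2 : ℂ) =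
      ∫ r in Ioi (0 : ℝ), ∫ y : ℝ, κ * mellin f (-((σ₀ : ℂ) + y * I)) * ((r : ℂ) ^ ((σ₀ : ℂ) + y * I) * (conj (g r) * (r : ℂ) ^ (-2 : ℂ))) := by
    refine setIntegral_congr_fun measurableSet_Ioi fun r hr => ?_
    rw [eq_integral_cpow_mul_mellin_neg hf hfs hf0 σ₀ hr, mul_assoc, mul_assoc, ← integral_mul_const, ← integral_const_mul]
    exact integral_congr_ae (Eventually.of_forall fun y => by ring)
  -- Step 2: Fubini
  have hswap := integral_integral_swap_of_le
    (Φ := fun r y => κ * mellin f (-((σ₀ : ℂ) + y * I)) * ((r : ℂ) ^ ((σ₀ : ℂ) + y * I) * (conj (g r) * (r : ℂ) ^ (-2 : ℂ))))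
    (a := fun r => ‖κ‖ * ‖(r : ℂ) ^ ((σ₀ : ℂ) - 2) * g r‖) (b := fun y => ‖mellin f (-((σ₀ : ℂ) + y * I))‖) ?_ ?_ hFi ?_
  rotate_left
  · -- joint continuity on `(0,∞) × ℝ`
    have hκc : ContinuousOn (fun _ : ℝ × ℝ => κ) (Ioi (0 : ℝ) ×ˢ univ) := continuousOn_const
    have hF2 : ContinuousOn (fun p : ℝ × ℝ => mellin f (-((σ₀ : ℂ) + p.2 * I))) (Ioi (0 : ℝ) ×ˢ univ) := (hFc.comp continuous_snd).continuousOn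
    have hg2 : ContinuousOn (fun p : ℝ × ℝ => conj (g p.1) * (p.1 : ℂ) ^ (-2 : ℂ)) (Ioi (0 : ℝ) ×ˢ univ) := by
      intro p hp
      exact (((continuous_conj.comp hgc).continuousAt.comp continuousAt_fst).mul
        ((continuousAt_ofReal_cpow_const p.1 (-2) (Or.inr (ne_of_gt hp.1))).comp continuousAt_fst)).continuousWithinAt
    exact (hκc.mul hF2).mul ((continuousOn_cpow_two σ₀).mul hg2)
  · exact ((integrable_ofReal_cpow_mul hgc hgs hg0 _).norm.const_mul _).integrableOn
  · intro r hr y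
    have hr0 : (0 : ℝ) < r := hr
    simp only [norm_mul, norm_cpow_eq_rpow_re_of_pos hr0, RCLike.norm_conj, add_re, ofReal_re, mul_re, I_re, mul_zero,
      ofReal_im, I_im, mul_one, sub_self, add_zero, sub_re, neg_re, re_ofNat]
    rw [Real.rpow_sub hr0, Real.rpow_neg hr0.le, div_eq_mul_inv]
    exact le_of_eq (by ring)
  -- Step 3: evaluate the inner `r`-integral as a Mellin transform of `conj g`
  rw [h1, hswap.2]
  have h3 : ∀ y : ℝ, ∫ r in Ioi (0 : ℝ), κ * mellin f (-((σ₀ : ℂ) + y * I)) * ((r : ℂ) ^ ((σ₀ : ℂ) + y * I) * (conj (g r) * (r : ℂ) ^ (-2 : ℂ))) =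
      κ * mellin f (-((σ₀ : ℂ) + y * I)) * conj (mellin g (conj ((σ₀ : ℂ) + y * I) - 1)) := by
    intro y
    rw [integral_const_mul]
    congr 1
    rw [show conj ((σ₀ : ℂ) + y * I) - 1 = conj ((σ₀ : ℂ) + y * I - 1) by rw [map_sub, map_one], ← mellin_conj]
    simp only [mellin, smul_eq_mul]
    refine setIntegral_congr_fun measurableSet_Ioi fun r hr => ?_
    have hr' : (r : ℂ) ≠ 0 := ofReal_ne_zero.2 hr.ne'
    rw [show (r : ℂ) ^ ((σ₀ : ℂ) + y * I - 1 - 1) = (r : ℂ) ^ ((σ₀ : ℂ) + y * I) * (r : ℂ) ^ (-2 : ℂ) by rw [← cpow_add _ _ hr']; congr 1; ring]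
    ring
  simp_rw [h3]
  rw [← integral_const_mul]
  exact integral_congr_ae (Eventually.of_forall fun y => by ring)

/-- `conj (σ₀ + iy) = σ₀ + i(−y)`. [folklore] -/
theorem conj_vertical (σ₀ y : ℝ) : conj ((σ₀ : ℂ) + y * I) = (σ₀ : ℂ) + ((-y : ℝ) : ℂ) * I := by
  simp only [map_add, conj_ofReal, map_mul, conj_I, ofReal_neg]
  ring

/-- **PARSEVAL II** (the `w = w₀` term of MW II.2.1 in rank one): for `f ∈ C_c((0,∞))`, `g ∈ C²_c((0,∞))`, any `σ₀`, and a coefficient `c` continuous and bounded on the line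
`Re = σ₀` (the intertwining scalar `c(z) = ∫_{N(𝔸)} H(w₀v)^z dν` there), with `(Mg)(r) := (2π)⁻¹∫ g̃(w)·c(w)·r^{1−w} dy′` (`w = σ₀+iy′`):
`∫_0^∞ f(r)·r^{−2}·conj (Mg)(r) dr = (2π)⁻¹ ∫_ℝ f̃(z)·conj g̃(z̄)·conj c(z̄) dy` (`z = σ₀+iy`; `f̃ = mellin f (−·)`). [cite: MoeglinWaldspurger1995, II.2.1] [cite: Titchmarsh1948, Thm 71–72] -/
theorem setIntegral_mul_cpow_mul_conj_integral_eq (hfc : Continuous f) (hfs : HasCompactSupport f) (hf0 : tsupport f ⊆ Ioi 0)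
    (hg : ContDiff ℝ 2 g) (hgs : HasCompactSupport g) (hg0 : tsupport g ⊆ Ioi 0) (σ₀ : ℝ)
    {c : ℂ → ℂ} (hcc : Continuous fun y : ℝ => c ((σ₀ : ℂ) + y * I)) {C₀ : ℝ} (hcb : ∀ y : ℝ, ‖c ((σ₀ : ℂ) + y * I)‖ ≤ C₀) :
    ∫ r in Ioi (0 : ℝ), f r * (r : ℂ) ^ (-2 : ℂ) *
        conj ((((2 * π)⁻¹ : ℝ) : ℂ) * ∫ y : ℝ, mellin g (-((σ₀ : ℂ) + y * I)) * c ((σ₀ : ℂ) + y * I) * (r : ℂ) ^ (1 - ((σ₀ : ℂ) + y * I))) =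
      (((2 * π)⁻¹ : ℝ) : ℂ) * ∫ y : ℝ, mellin f (-((σ₀ : ℂ) + y * I)) * conj (mellin g (-conj ((σ₀ : ℂ) + y * I))) * conj (c (conj ((σ₀ : ℂ) + y * I))) := by
  set κ : ℂ := (((2 * π)⁻¹ : ℝ) : ℂ) with hκ
  have hκc : conj κ = κ := by rw [hκ, conj_ofReal]
  have hC₀ : 0 ≤ C₀ := (norm_nonneg _).trans (hcb 0)
  -- integrability of `g̃` on the line
  have hGc : Continuous fun y : ℝ => mellin g (-((σ₀ : ℂ) + y * I)) :=
    (differentiable_mellin hg.continuous hgs hg0).continuous.comp (by fun_prop)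
  have hGi : Integrable fun y : ℝ => ‖mellin g (-((σ₀ : ℂ) + y * I))‖ := by
    have h := (verticalIntegrable_mellin hg hgs hg0 (-σ₀)).comp_neg
    refine (h.congr (Eventually.of_forall fun y => ?_)).norm
    simp only [ofReal_neg]; congr 1; ring
  -- Step 1: conjugate inside, pointwise in `r > 0`
  have h1 : ∫ r in Ioi (0 : ℝ), f r * (r : ℂ) ^ (-2 : ℂ) *
        conj (κ * ∫ y : ℝ, mellin g (-((σ₀ : ℂ) + y * I)) * c ((σ₀ : ℂ) + y * I) * (r : ℂ) ^ (1 - ((σ₀ : ℂ) + y * I))) =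
      ∫ r in Ioi (0 : ℝ), ∫ y : ℝ, κ * (conj (mellin g (-((σ₀ : ℂ) + y * I))) * conj (c ((σ₀ : ℂ) + y * I))) *
        (f r * ((r : ℂ) ^ (-2 : ℂ) * (r : ℂ) ^ conj (1 - ((σ₀ : ℂ) + y * I)))) := by
    refine setIntegral_congr_fun measurableSet_Ioi fun r hr => ?_
    have hr0 : (0 : ℝ) ≤ r := le_of_lt hr
    rw [map_mul, hκc, ← integral_conj, ← mul_assoc, ← integral_const_mul]
    have harg : ((r : ℂ)).arg ≠ π := by rw [arg_ofReal_of_nonneg hr0]; exact Real.pi_pos.ne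
    have hcj : ∀ m : ℂ, conj ((r : ℂ) ^ m) = (r : ℂ) ^ conj m := fun m => by rw [cpow_conj _ _ harg, conj_ofReal]
    refine integral_congr_ae (Eventually.of_forall fun y => ?_)
    dsimp only; rw [map_mul, map_mul, hcj]; ring
  -- Step 2: Fubini
  have hswap := integral_integral_swap_of_le
    (Φ := fun r y => κ * (conj (mellin g (-((σ₀ : ℂ) + y * I))) * conj (c ((σ₀ : ℂ) + y * I))) *
        (f r * ((r : ℂ) ^ (-2 : ℂ) * (r : ℂ) ^ conj (1 - ((σ₀ : ℂ) + y * I)))))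
    (a := fun r => ‖κ‖ * ‖(r : ℂ) ^ (-(1 : ℂ) - σ₀) * f r‖) (b := fun y => C₀ * ‖mellin g (-((σ₀ : ℂ) + y * I))‖) ?_ ?_ (hGi.const_mul C₀) ?_
  rotate_left
  · -- joint continuity on `(0,∞) × ℝ`
    have hA : ContinuousOn (fun p : ℝ × ℝ => κ * (conj (mellin g (-((σ₀ : ℂ) + p.2 * I))) * conj (c ((σ₀ : ℂ) + p.2 * I)))) (Ioi (0 : ℝ) ×ˢ univ) :=
      (continuous_const.mul (((continuous_conj.comp hGc).mul (continuous_conj.comp hcc)).comp continuous_snd)).continuousOn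
    have hpow : ContinuousOn (fun p : ℝ × ℝ => (p.1 : ℂ) ^ conj (1 - ((σ₀ : ℂ) + p.2 * I))) (Ioi (0 : ℝ) ×ˢ univ) := by
      intro p hp
      have h1 : ContinuousAt (fun q : ℝ × ℝ => (q.1 : ℂ)) p := (continuous_ofReal.comp continuous_fst).continuousAt
      have h2 : ContinuousAt (fun q : ℝ × ℝ => conj (1 - ((σ₀ : ℂ) + q.2 * I))) p := by fun_prop
      exact (h1.cpow h2 (ofReal_mem_slitPlane.2 hp.1)).continuousWithinAt
    have hB : ContinuousOn (fun p : ℝ × ℝ => f p.1 * ((p.1 : ℂ) ^ (-2 : ℂ) * (p.1 : ℂ) ^ conj (1 - ((σ₀ : ℂ) + p.2 * I)))) (Ioi (0 : ℝ) ×ˢ univ) := by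
      refine ((hfc.comp continuous_fst).continuousOn).mul (ContinuousOn.mul (fun p hp => ?_) hpow)
      exact ((continuousAt_ofReal_cpow_const p.1 (-2) (Or.inr (ne_of_gt hp.1))).comp continuousAt_fst).continuousWithinAt
    exact hA.mul hB
  · exact ((integrable_ofReal_cpow_mul hfc hfs hf0 _).norm.const_mul _).integrableOn
  · intro r hr y
    have hr0 : (0 : ℝ) < r := hr
    simp only [norm_mul, norm_cpow_eq_rpow_re_of_pos hr0, RCLike.norm_conj, conj_re, add_re, ofReal_re, mul_re, I_re, mul_zero,
      ofReal_im, I_im, mul_one, sub_self, add_zero, sub_re, neg_re, re_ofNat, one_re]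
    rw [← Real.rpow_add hr0, show (-2 : ℝ) + (1 - σ₀) = -1 - σ₀ by ring]
    have hc' := hcb y
    have h3 : 0 ≤ ‖κ‖ * ‖mellin g (-((σ₀ : ℂ) + y * I))‖ * (‖f r‖ * r ^ (-1 - σ₀)) := by positivity
    calc ‖κ‖ * (‖mellin g (-((σ₀ : ℂ) + y * I))‖ * ‖c ((σ₀ : ℂ) + y * I)‖) * (‖f r‖ * r ^ (-1 - σ₀))
        = (‖κ‖ * ‖mellin g (-((σ₀ : ℂ) + y * I))‖ * (‖f r‖ * r ^ (-1 - σ₀))) * ‖c ((σ₀ : ℂ) + y * I)‖ := by ring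
      _ ≤ (‖κ‖ * ‖mellin g (-((σ₀ : ℂ) + y * I))‖ * (‖f r‖ * r ^ (-1 - σ₀))) * C₀ := mul_le_mul_of_nonneg_left hc' h3
      _ = ‖κ‖ * (r ^ (-1 - σ₀) * ‖f r‖) * (C₀ * ‖mellin g (-((σ₀ : ℂ) + y * I))‖) := by ring
  -- Step 3: the inner `r`-integral is `mellin f (−conj w)`
  rw [h1, hswap.2]
  have h3 : ∀ y : ℝ, ∫ r in Ioi (0 : ℝ), κ * (conj (mellin g (-((σ₀ : ℂ) + y * I))) * conj (c ((σ₀ : ℂ) + y * I))) *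
        (f r * ((r : ℂ) ^ (-2 : ℂ) * (r : ℂ) ^ conj (1 - ((σ₀ : ℂ) + y * I)))) =
      κ * (conj (mellin g (-((σ₀ : ℂ) + y * I))) * conj (c ((σ₀ : ℂ) + y * I))) * mellin f (-conj ((σ₀ : ℂ) + y * I)) := by
    intro y
    rw [integral_const_mul]
    congr 1
    simp only [mellin, smul_eq_mul]
    refine setIntegral_congr_fun measurableSet_Ioi fun r hr => ?_
    have hr' : (r : ℂ) ≠ 0 := ofReal_ne_zero.2 hr.ne'
    rw [show (r : ℂ) ^ (-conj ((σ₀ : ℂ) + y * I) - 1) = (r : ℂ) ^ (-2 : ℂ) * (r : ℂ) ^ conj (1 - ((σ₀ : ℂ) + y * I)) by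
      rw [← cpow_add _ _ hr']; congr 1; rw [map_sub, map_one]; ring]
    ring
  simp_rw [h3]
  -- Step 4: `y ↦ −y` turns `w` into `conj z`
  rw [← integral_const_mul, ← integral_neg_eq_self]
  refine integral_congr_ae (Eventually.of_forall fun y => ?_)
  dsimp only; rw [← conj_vertical σ₀ y, conj_conj]; ring

end Summit.HodgeConjecture.HodgeConjecture.Cruxes.H413.K2E1MellinPaleyWienerHalfLine

end
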